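import Summits.CriticalPhenomena.CardyFormulaZ2.Theorems.ParafermionPrecompact.Negative.ParafermionPrecompactFalseOfBulkNondegenerate
import Literature.Probability.LatticeModels.FermionicObservableSums

/-!
# `ParafermionPrecompact` (stmt-CriticalPhenomena-11293): the bound `‖F_δ‖ ≤ C δ^{1/3}` fails at
# the discrete marked point — interiority `K ⊆ Ω` and compactness of `K` are load-bearing

Refuter `refuter-cdisprove-stmt-CriticalPhenomena-11293-g2-0` (cdisprove, cycle 2).  Kernel-checked
complements to `ParafermionPrecompactFalseOfBulkNondegenerate.lean` (cycle 1), in the same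
namespace and vocabulary (`F`, `IsFamily`, `ClauseBound(Edges)`, `ClauseEquicont(Edges)`):

* §1–§2 **The first medial vertex is passed exactly once, with winding `0`.**  For admissible
  Dobrushin data the exploration path is the cut orbit of the start corner
  (`medialExploration_eq_explorationList`); its head `e_a = cSrc (startCorner hD)` — an `A`–`B`
  edge, the same for every configuration — is never revisited (`cSrc_cornerOrbit_ne_cSrc_start`:
  a later corner with source `e_a` would either be the start corner again, excluded by
  injectivity of the orbit, or have its left vertex on the arc `B`, excluded by the left-vertex
  invariant), so `passageSum (medialExploration D ω) δ σ e_a = 1` for EVERY `ω`, `δ`, `σ`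
  (`passageSum_medialExploration_headEdge`), whence `F Λ δ e_a = 1` (`F_headEdge`).  No `def` is
  introduced (the crux work file `Cruxes/ParafermionPrecompact/Disproof.lean` carries the readable
  abbreviations `headEdge`, `ClauseBoundEdgesExp`, …).
* §3 **Consequences (load-bearing hypotheses of the crux and of its repair `C′`).**  For EVERY
  Dobrushin domain and EVERY admissible family, clause (i) — even in its repaired, edge-guarded
  form, and at every exponent `s > 0` — is FALSE on `K = closure Ω` (compact, but not inside the
  open carrier: `not_clauseBoundExp_closure`, `not_clauseBoundEdges_closure`,
  `not_clauseBound_closure`) and, for convex `Ω`, FALSE on `K = Ω` itself (inside the carrier but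
  not compact: `not_clauseBoundEdges_carrier_of_convex`).  So both `IsCompact K` and
  `K ⊆ D.carrier` are load-bearing in `ParafermionPrecompact` / `ParafermionPrecompactRepairedAt`:
  any proof of (i) must use that `K` stays at positive distance from `∂Ω` (where the
  normalisation `δ^{-1/3}` blows up: `‖F_δ(e_a)‖ = 1`).  Packaged: C′ with `K := closure Ω`
  fails for every family (`repairedUpToBoundary_false_at`), hence is false
  outright as soon as ONE admissible family of ONE domain exists (`not_repairedUpToBoundary_of`,
  modulo the non-vacuity `∃ D Λ, IsFamily D Λ` = one instance of the route's own support item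
  `DiscretisationFamilyExists`, stmt-9644).
(Companion file `TwoPassages.lean`: at most two passages per medial vertex, the free exponent `0`,
  exponent bookkeeping.)
-/

noncomputable section

namespace Summit.CriticalPhenomena.CardyFormulaZ2.Theorems.ParafermionPrecompact.Negative

open _root_.Literature.Probability.LatticeModels _root_.Literature.Probability.RandomPlanarGeometry
open _root_.Literature.Probability.Percolation _root_.MeasureTheory _root_.Filter _root_.Set
open _root_.Literature.Probability.LatticeModels.DiscreteDobrushin (startCorner exitTime
  isStartCorner_startCorner medialExploration_eq_explorationList isInnerFace_of_lt_exitTime)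
open scoped _root_.Topology

/-! ## §1 Passage sums along the cut orbit (for the `MedialPath` copy of `passageSum`) -/

/-- Passages of the cut orbit through `z` are its positions `k ≤ N` whose corner has source `z`
(the `MedialWinding`/`MedialPath` copy of `passageSum_explorationList`). [folklore] -/
theorem medialPath_passageSum_explorationList {β : BondConfig (Site 2)} {c₀ : Site 2 × Fin 4}
    (δ spin : ℝ) (N : ℕ) (z : MedialVertex) :
    MedialPath.passageSum (explorationList β c₀ N) δ spin z =
      ∑ k ∈ (Finset.range (N + 1)).filter (fun k => cSrc (cornerOrbit β c₀ k) = z),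
        Complex.exp (-Complex.I * spin * (MedialPath.windingAt (explorationList β c₀ N) δ k : ℝ)) := by
  rw [MedialPath.passageSum, length_explorationList']
  refine Finset.sum_congr ?_ fun _ _ => rfl
  refine Finset.filter_congr fun k hk => ?_
  rw [Finset.mem_range] at hk
  rw [List.getElem?_eq_getElem (by rw [length_explorationList']; exact hk), getElem_explorationList',
    Option.some.injEq]

/-- The winding at the first position of any medial path vanishes (polylines with at most two
points have no turn). [folklore] -/
theorem windingAt_zero (γ : List MedialVertex) (δ : ℝ) : MedialPath.windingAt γ δ 0 = 0 := by
  unfold MedialPath.windingAt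
  match γ with
  | [] => simp
  | [_] => simp
  | _ :: _ :: _ => simp

/-! ## §2 The head `e_a` of the exploration is passed exactly once -/

section Head

variable {Dd : DiscreteDobrushin} {ω : BondConfig (Site 2)} {c₀ : Site 2 × Fin 4}

/-- **No return to `e_a`.**  Along the orbit of a start corner, as long as the faces stay inner,
no later corner has the start edge `e_a = cSrc c₀` as its source: such a corner is either `c₀`
itself (excluded: the orbit is injective before it leaves the inner faces, `cornerOrbit_ne`) or
the corner sourced at the `B`-end of `e_a` (excluded: left vertices of the orbit lie on the arc
`A` or on an open edge, `cornerOrbit_inv`, never on the arc `B`). [folklore] -/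
theorem cSrc_cornerOrbit_ne_cSrc_start (hD : Dd.IsZdAdmissible) (hc₀ : Dd.IsStartCorner c₀)
    {k : ℕ} (hk : 0 < k)
    (hinner : ∀ i < k, Dd.IsInnerFace (cFace (cornerOrbit (Dd.bcBondConfig ω) c₀ i))) :
    cSrc (cornerOrbit (Dd.bcBondConfig ω) c₀ k) ≠ cSrc c₀ := by
  intro h
  set p := cornerOrbit (Dd.bcBondConfig ω) c₀ k with hp
  rcases Sym2.eq_iff.1 h with ⟨h1, h2⟩ | ⟨h1, h2⟩
  · -- same vertex, same direction: `p = c₀ = orb 0`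
    have hdir : p.2 = c₀.2 := by
      rw [h1] at h2
      exact cornerUnit_injective (add_left_cancel h2)
    have hpc : p = c₀ := Prod.ext h1 hdir
    exact cornerOrbit_ne hD hc₀ hk hinner (by rw [cornerOrbit_zero]; exact hpc.symm)
  · -- the left vertex of `p` is the `B`-end of `e_a`
    have hB : p.1 ∈ Dd.zdArcB := h1 ▸ hc₀.mem_zdArcB
    have hA : p.1 ∈ Dd.zdArcA :=
      DiscreteDobrushin.mem_zdArcA_of_inv hD (cornerOrbit_inv hc₀ k) (Or.inr hB)
    exact Set.disjoint_left.1 hD.disjoint hA hB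

/-! The head `e_a` of the exploration path of admissible data is `cSrc (startCorner hD)`: the
source edge of the start corner — an `A`–`B` edge of `Ω_δ`, independent of the configuration (no
`def` is introduced for it in this file; the crux work file abbreviates it `cSrc (startCorner hD)`). -/

/-- `e_a` is an `A`–`B` edge. [folklore] -/
theorem headEdge_mem_zdABEdges (hD : Dd.IsZdAdmissible) : cSrc (startCorner hD) ∈ Dd.zdABEdges :=
  DiscreteDobrushin.cSrc_mem_zdABEdges (isStartCorner_startCorner hD).mem_zdArcA
    (isStartCorner_startCorner hD).mem_zdArcB (Or.inl (isStartCorner_startCorner hD).isOutEdge)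

/-- `e_a` is a genuine medial vertex (a lattice edge). [folklore] -/
theorem headEdge_mem_edgeSet (hD : Dd.IsZdAdmissible) : cSrc (startCorner hD) ∈ (zdGraph 2).edgeSet :=
  cSrc_mem_edgeSet _

/-- `e_a` is the head of the exploration path of every configuration. [folklore] -/
theorem head_medialExploration (hD : Dd.IsZdAdmissible) (ω : BondConfig (Site 2)) :
    (medialExploration Dd ω).head? = some (cSrc (startCorner hD)) := by
  rw [medialExploration_eq_explorationList hD ω, List.head?_eq_some_head (explorationList_ne_nil _),
    head_explorationList]

/-- **The head is passed once, with winding zero**: for admissible data and EVERY configuration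
`ω`, mesh `δ` and spin `σ`, `passageSum (medialExploration D ω) δ σ e_a = 1`. [folklore] -/
theorem passageSum_medialExploration_headEdge (hD : Dd.IsZdAdmissible) (ω : BondConfig (Site 2))
    (δ σ : ℝ) : MedialPath.passageSum (medialExploration Dd ω) δ σ (cSrc (startCorner hD)) = 1 := by
  rw [medialExploration_eq_explorationList hD ω, medialPath_passageSum_explorationList]
  have hfilter : (Finset.range (exitTime hD ω + 1)).filter
      (fun k => cSrc (cornerOrbit (Dd.bcBondConfig ω) (startCorner hD) k) = cSrc (startCorner hD)) = {0} := by
    ext k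
    simp only [Finset.mem_filter, Finset.mem_range, Finset.mem_singleton]
    constructor
    · rintro ⟨hk, h⟩
      by_contra hk0
      exact cSrc_cornerOrbit_ne_cSrc_start hD (isStartCorner_startCorner hD) (Nat.pos_of_ne_zero hk0)
        (fun i hi => isInnerFace_of_lt_exitTime hD ω (by omega)) h
    · rintro rfl
      exact ⟨Nat.succ_pos _, rfl⟩
  rw [hfilter, Finset.sum_singleton, windingAt_zero]
  simp

/-- The medial point of `e_a` lies in the closed domain (edges of `Ω_δ` are closed segments of
`Ω̄`). [folklore] -/
theorem medialPoint_headEdge_mem_closure (hD : Dd.IsZdAdmissible) :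
    medialPoint Dd.δ (cSrc (startCorner hD)) ∈ closure Dd.Ω := by
  have he := (headEdge_mem_zdABEdges hD).1
  unfold cSrc at he ⊢
  have hseg := (meshGraph_adj_iff.1 (discreteDomainGraph_le_meshGraph _ _ he)).2
  rw [medialPoint_mk]
  refine hseg ⟨1 / 2, 1 / 2, by norm_num, by norm_num, by norm_num, ?_⟩
  simp only [Complex.real_smul]
  push_cast
  ring

/-- For a convex domain the medial point of `e_a` lies in `Ω` itself (both endpoints are mesh
vertices of `Ω`). [folklore] -/
theorem medialPoint_headEdge_mem_of_convex (hD : Dd.IsZdAdmissible) (hconv : Convex ℝ Dd.Ω) :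
    medialPoint Dd.δ (cSrc (startCorner hD)) ∈ Dd.Ω := by
  have he := (headEdge_mem_zdABEdges hD).1
  unfold cSrc at he ⊢
  obtain ⟨-, hx, hy⟩ := discreteDomainGraph_adj_iff.1 he
  have hx' := meshDomain_subset_meshVertices _ _ hx
  have hy' := meshDomain_subset_meshVertices _ _ hy
  rw [mem_meshVertices_iff] at hx' hy'
  rw [medialPoint_mk]
  have := hconv hx' hy' (by norm_num : (0:ℝ) ≤ 1 / 2) (by norm_num : (0:ℝ) ≤ 1 / 2) (by norm_num)
  convert this using 1
  simp only [Complex.real_smul]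
  push_cast
  ring

end Head

/-! ## §3 Consequences: clause (i) fails at the discrete marked point `a_δ` -/

section Consequences

variable {D : DobrushinDomain} {Λ : ℝ → DiscreteDobrushin}

/-- **`F = 1` at the head**: for a family member with admissible data,
`F Λ δ e_a = ∫ 1 dP_{1/2} = 1`. [folklore] -/
theorem F_headEdge (Λ : ℝ → DiscreteDobrushin) {δ : ℝ} (hD : (Λ δ).IsZdAdmissible) :
    F Λ δ (cSrc (startCorner hD)) = 1 := by
  simp [F, passageSum_medialExploration_headEdge hD]

/-- `‖F Λ δ e_a‖ = 1`. [folklore] -/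
theorem norm_F_headEdge (Λ : ℝ → DiscreteDobrushin) {δ : ℝ} (hD : (Λ δ).IsZdAdmissible) :
    ‖F Λ δ (cSrc (startCorner hD))‖ = 1 := by
  rw [F_headEdge Λ hD, norm_one]

/-- `C δ^s < 1` for all small `δ > 0` when `s > 0`. [folklore] -/
theorem eventually_const_mul_rpow_lt_one (C : ℝ) {s : ℝ} (hs : 0 < s) :
    ∀ᶠ δ in 𝓝[>] (0:ℝ), C * δ ^ s < 1 := by
  have h0 : Tendsto (fun δ : ℝ => δ ^ s) (𝓝[>] (0:ℝ)) (𝓝 0) := by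
    have := ((Real.continuousAt_rpow_const 0 s (Or.inr hs.le)).tendsto).mono_left
      (nhdsWithin_le_nhds (s := Set.Ioi (0:ℝ)))
    simpa [Real.zero_rpow hs.ne'] using this
  have h1 : Tendsto (fun δ : ℝ => C * δ ^ s) (𝓝[>] (0:ℝ)) (𝓝 0) := by
    simpa using h0.const_mul C
  exact h1.eventually_lt_const zero_lt_one

/-- **Interiority is load-bearing, at every exponent.**  For EVERY Dobrushin domain and EVERY
admissible discretisation family, the (repaired) bound clause with `K := closure Ω` — a compact
set which is NOT contained in the open carrier — fails for every exponent `s > 0`: the head `e_a`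
of the exploration is a genuine medial vertex with medial point in `Ω̄` and `‖F Λ δ e_a‖ = 1`.
[folklore] -/
theorem not_clauseBoundExp_closure (hΛ : IsFamily D Λ) {s : ℝ} (hs : 0 < s) :
    ¬ ∃ C : ℝ, ∀ᶠ δ in 𝓝[>] 0, ∀ z : MedialVertex, z ∈ (zdGraph 2).edgeSet →
      medialPoint δ z ∈ closure D.carrier → ‖F Λ δ z‖ ≤ C * δ ^ s := by
  rintro ⟨C, hC⟩
  obtain ⟨hΩ, hδ, -, -, -, hadm⟩ := hΛ
  obtain ⟨δ, hCδ, hD, hlt⟩ := (hC.and (hadm.and (eventually_const_mul_rpow_lt_one C hs))).exists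
  have hmem : medialPoint δ (cSrc (startCorner hD)) ∈ closure D.carrier := by
    have := medialPoint_headEdge_mem_closure hD
    rwa [hδ δ, hΩ δ] at this
  have := hCδ (cSrc (startCorner hD)) (headEdge_mem_edgeSet hD) hmem
  rw [norm_F_headEdge Λ hD] at this
  linarith

/-- In particular the repaired clause (i) of `C′` fails on `K = closure Ω` for every admissible
family: `K ⊆ D.carrier` cannot be weakened to `K ⊆ closure D.carrier` in
`ParafermionPrecompactRepairedAt`. [folklore] -/
theorem not_clauseBoundEdges_closure (hΛ : IsFamily D Λ) : ¬ ClauseBoundEdges Λ (closure D.carrier) :=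
  not_clauseBoundExp_closure hΛ (by norm_num : (0:ℝ) < 1 / 3)

/-- The same for the unguarded clause (i) of the crux as typed. [folklore] -/
theorem not_clauseBound_closure (hΛ : IsFamily D Λ) : ¬ ClauseBound Λ (closure D.carrier) := by
  rintro ⟨C, hC⟩
  exact not_clauseBoundEdges_closure hΛ ⟨C, by filter_upwards [hC] with δ h z _ hz using h z hz⟩

/-- **Compactness is load-bearing.**  For a CONVEX Dobrushin domain and every admissible family,
the repaired clause (i) fails on `K := Ω` itself (inside the carrier, not compact): the medial
point of `e_a` is the midpoint of two mesh vertices of `Ω`. [folklore] -/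
theorem not_clauseBoundEdges_carrier_of_convex (hconv : Convex ℝ D.carrier) (hΛ : IsFamily D Λ) :
    ¬ ClauseBoundEdges Λ D.carrier := by
  rintro ⟨C, hC⟩
  obtain ⟨hΩ, hδ, -, -, -, hadm⟩ := hΛ
  obtain ⟨δ, hCδ, hD, hlt⟩ :=
    (hC.and (hadm.and (eventually_const_mul_rpow_lt_one C (by norm_num : (0:ℝ) < 1 / 3)))).exists
  have hmem : medialPoint δ (cSrc (startCorner hD)) ∈ D.carrier := by
    have := medialPoint_headEdge_mem_of_convex hD (by rw [hΩ δ]; exact hconv)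
    rwa [hδ δ, hΩ δ] at this
  have := hCδ (cSrc (startCorner hD)) (headEdge_mem_edgeSet hD) hmem
  rw [norm_F_headEdge Λ hD] at this
  linarith

/-- **`C′` up to the boundary fails AT every admissible family**: the repaired clauses with the
interiority hypothesis dropped (compact `K := closure Ω` instead of compact `K ⊆ Ω`) never hold
together (universally quantified negative form, unconditional). [folklore] -/
theorem repairedUpToBoundary_false_at (hΛ : IsFamily D Λ) :
    ¬ (ClauseBoundEdges Λ (closure D.carrier) ∧ ClauseEquicontEdges Λ (closure D.carrier)) :=
  fun h => not_clauseBoundEdges_closure hΛ h.1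

/-- Hence "`C′` up to the boundary" (`∀ D Λ, IsFamily D Λ → clauses on closure Ω`) is false as
soon as one admissible family of one Dobrushin domain exists (one instance of the route's support
item `DiscretisationFamilyExists`, stmt-9644; not yet constructed in the tree for any domain).
[folklore] -/
theorem not_repairedUpToBoundary_of (h : ∃ (D : DobrushinDomain) (Λ : ℝ → DiscreteDobrushin), IsFamily D Λ) :
    ¬ ∀ (D : DobrushinDomain) (Λ : ℝ → DiscreteDobrushin), IsFamily D Λ →
      ClauseBoundEdges Λ (closure D.carrier) ∧ ClauseEquicontEdges Λ (closure D.carrier) := by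
  obtain ⟨D, Λ, hΛ⟩ := h
  exact fun hR => repairedUpToBoundary_false_at hΛ (hR D Λ hΛ)

end Consequences

end Summit.CriticalPhenomena.CardyFormulaZ2.Theorems.ParafermionPrecompact.Negative

end
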